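import Summits.HubbardSuperconductivity.HubbardSuperconductivity.Theorems.LevyLogBootstrapBlock2InfDivXXZKernelCovariance
import Summits.HubbardSuperconductivity.HubbardSuperconductivity.Theorems.LevyLogBootstrapBlock2InfDivXXZKernelRP
import Literature.MathematicalPhysics.QuantumLattice.SpinChainsLiebMattisProofs
import Literature.MathematicalPhysics.QuantumLattice.HeisenbergOrderMerminWagnerProofs
import Literature.MathematicalPhysics.QuantumLattice.XYOrderReflection
import Literature.Analysis.Matrix.HankelBlockLogConvex
import HarnessLib

/-!
# Crux `Block2InfDivXXZ` (stmt-HubbardSuperconductivity-15048, route `LevyLogBootstrap`):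
# reflection positivity ⇒ the odd-shift Hankel form of the two-row transverse row function is
# positive semidefinite

Support file for the crux `Block2InfDivXXZ` (infinite divisibility of the 2×2-block transverse
kernel of the `S^z_tot = 0` ground state `ψ` of `H_M(Δ) = xxzHamiltonian 1 (torusGraph 2 M) (-1) Δ`).
The foreseen split `AxisInfDiv` of the route ("RP ⇒ infinite divisibility along a coarse axis") needs,
as its reflection-positivity input, positive semidefiniteness of the ODD-SHIFT HANKEL FORM
`Σ_{i,i'<m} c_i c_{i'} F(i + i' + 1)` (`M = 2m`) of the two-row transverse row function
`F(s) = Σ_{b,b'<2} Re⟨ψ, S⁺_{(s, b'-b)} S⁻_0 ψ⟩` — the correlation, summed over the two rows of a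
2-block, between a fine column and a fine column at separation `s`. This file derives it from the
landed ground-state reflection positivity of the transverse `S¹S¹` Gram matrices
(`sectorGS_transverseGram_posSemidef_of_sectorGS`, file `…Block2InfDivXXZKernelRP.lean`, planes
`(j, a) = (0, -1)`), for every `Δ ≤ 0` and even `M ≥ 4`:

* `expect_raise_raise_eq_zero`, `expect_lower_lower_eq_zero` — selection rules
  `⟨ψ, S⁺_p S⁺_q ψ⟩ = ⟨ψ, S⁻_p S⁻_q ψ⟩ = 0` in a magnetisation sector (`p ≠ q`);
* `re_expect_siteSpin_zero_mul` — `Re⟨ψ, S¹_p S¹_q ψ⟩ = ½ Re⟨ψ, S⁺_p S⁻_q ψ⟩` (`p ≠ q`) for sector states;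
* `rowHankelOddForm_nonneg` (registered sub-goal) — `0 ≤ hankelOddForm F m c c` for every real `c`
  (test the Gram matrix of the `2m` left sites `(i, b)`, `i < m`, `b < 2`, with the row-constant
  vector `c_i`; translation invariance `gs_transverseKernel_eq_sub` turns the entries into
  `½ F(i + i' + 1)`).

With `Literature.Analysis.Matrix.hankelBlock_logConvex` this yields log-convexity of the block kernel
along a coarse axis at every centre `n ≥ 2` (sibling file `…Block2InfDivXXZAxisLogConvex.lean`).
Kennedy–Lieb–Shastry, J. Stat. Phys. 53 (1988) eqs. (15)–(25); Dyson–Lieb–Simon (1978) §4;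
Tasaki (2020) §2.2–2.4. No definition is introduced; sorry-free.
-/

noncomputable section

set_option linter.dupNamespace false

namespace Summit.HubbardSuperconductivity.HubbardSuperconductivity.Theorems.LevyLogBootstrap

open scoped BigOperators Matrix ComplexOrder ComplexConjugate
open Matrix Finset Complex
open Literature.MathematicalPhysics.QuantumLattice Literature.Probability.LatticeModels
open Literature.Analysis.Matrix

/-! ### Sector selection rules: `⟨ψ, S⁺_p S⁺_q ψ⟩ = ⟨ψ, S⁻_p S⁻_q ψ⟩ = 0` in a magnetisation sector -/

section Sector

variable {Λ : Type*} [Fintype Λ] [DecidableEq Λ]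

/-- In a fixed magnetisation sector the double-raising expectation vanishes:
`⟨ψ, S⁺_p S⁺_q ψ⟩ = 0` for `p ≠ q` (the operator changes the magnetisation by `2`; sectors are
coordinate subspaces, `mem_spinZSector_iff`). Tasaki (2020) §2.4. [folklore] -/
theorem expect_raise_raise_eq_zero {μ : ℝ} {ψ : TensorIndex Λ 2 → ℂ}
    (hψ : ψ ∈ @spinZSector Λ _ _ 1 μ) {p q : Λ} (hpq : p ≠ q) :
    star ψ ⬝ᵥ (onSite p (spinRaise 1) * onSite q (spinRaise 1)) *ᵥ ψ = 0 := by
  rw [dotProduct]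
  refine Finset.sum_eq_zero fun σ _ => ?_
  rw [mulVec, dotProduct, Finset.mul_sum]
  refine Finset.sum_eq_zero fun τ _ => ?_
  by_cases hσ : ψ σ = 0
  · simp [hσ]
  by_cases hτ : ψ τ = 0
  · simp [hτ]
  -- both `σ` and `τ` have magnetisation `μ`, but a nonzero entry shifts the weight by `2`
  have hmσ : mag 1 σ = μ := by
    by_contra h
    exact hσ ((mem_spinZSector_iff 1 μ ψ).1 hψ σ h)
  have hmτ : mag 1 τ = μ := by
    by_contra h
    exact hτ ((mem_spinZSector_iff 1 μ ψ).1 hψ τ h)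
  have hw : ∑ z, (σ z).val = ∑ z, (τ z).val := (mag_eq_mag_iff (n := 1) σ τ).1 (hmσ.trans hmτ.symm)
  rw [onSite_mul_onSite_apply hpq]
  split_ifs with hoff
  · by_cases hp : spinRaise 1 (σ p) (τ p) = 0
    · simp [hp]
    by_cases hq : spinRaise 1 (σ q) (τ q) = 0
    · simp [hq]
    exfalso
    have hp' := spinRaise_apply_ne_zero 1 hp
    have hq' := spinRaise_apply_ne_zero 1 hq
    -- the weight of `τ` exceeds that of `σ` by `2`
    have hsum : ∑ z, (τ z).val = ∑ z, (σ z).val + 2 := by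
      have e1 : ∑ z, (τ z).val = (τ p).val + ∑ z ∈ Finset.univ.erase p, (τ z).val :=
        (Finset.add_sum_erase _ _ (Finset.mem_univ p)).symm
      have e2 : ∑ z, (σ z).val = (σ p).val + ∑ z ∈ Finset.univ.erase p, (σ z).val :=
        (Finset.add_sum_erase _ _ (Finset.mem_univ p)).symm
      have hq_mem : q ∈ Finset.univ.erase p := Finset.mem_erase.2 ⟨hpq.symm, Finset.mem_univ q⟩
      have e3 : ∑ z ∈ Finset.univ.erase p, (τ z).val =
          (τ q).val + ∑ z ∈ (Finset.univ.erase p).erase q, (τ z).val :=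
        (Finset.add_sum_erase _ _ hq_mem).symm
      have e4 : ∑ z ∈ Finset.univ.erase p, (σ z).val =
          (σ q).val + ∑ z ∈ (Finset.univ.erase p).erase q, (σ z).val :=
        (Finset.add_sum_erase _ _ hq_mem).symm
      have e5 : ∑ z ∈ (Finset.univ.erase p).erase q, (τ z).val =
          ∑ z ∈ (Finset.univ.erase p).erase q, (σ z).val := by
        refine Finset.sum_congr rfl fun z hz => ?_
        rw [Finset.mem_erase, Finset.mem_erase] at hz
        rw [hoff z hz.2.1 hz.1]
      rw [e1, e2, e3, e4, e5, hp', hq']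
      ring
    omega
  · simp

/-- In a fixed magnetisation sector the double-lowering expectation vanishes:
`⟨ψ, S⁻_p S⁻_q ψ⟩ = 0` for `p ≠ q`. Tasaki (2020) §2.4. [folklore] -/
theorem expect_lower_lower_eq_zero {μ : ℝ} {ψ : TensorIndex Λ 2 → ℂ}
    (hψ : ψ ∈ @spinZSector Λ _ _ 1 μ) {p q : Λ} (hpq : p ≠ q) :
    star ψ ⬝ᵥ (onSite p (spinLower 1) * onSite q (spinLower 1)) *ᵥ ψ = 0 := by
  rw [dotProduct]
  refine Finset.sum_eq_zero fun σ _ => ?_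
  rw [mulVec, dotProduct, Finset.mul_sum]
  refine Finset.sum_eq_zero fun τ _ => ?_
  by_cases hσ : ψ σ = 0
  · simp [hσ]
  by_cases hτ : ψ τ = 0
  · simp [hτ]
  have hmσ : mag 1 σ = μ := by
    by_contra h
    exact hσ ((mem_spinZSector_iff 1 μ ψ).1 hψ σ h)
  have hmτ : mag 1 τ = μ := by
    by_contra h
    exact hτ ((mem_spinZSector_iff 1 μ ψ).1 hψ τ h)
  have hw : ∑ z, (σ z).val = ∑ z, (τ z).val := (mag_eq_mag_iff (n := 1) σ τ).1 (hmσ.trans hmτ.symm)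
  rw [onSite_mul_onSite_apply hpq]
  split_ifs with hoff
  · by_cases hp : spinLower 1 (σ p) (τ p) = 0
    · simp [hp]
    by_cases hq : spinLower 1 (σ q) (τ q) = 0
    · simp [hq]
    exfalso
    have hp' := spinLower_apply_ne_zero 1 hp
    have hq' := spinLower_apply_ne_zero 1 hq
    have hsum : ∑ z, (σ z).val = ∑ z, (τ z).val + 2 := by
      have e1 : ∑ z, (τ z).val = (τ p).val + ∑ z ∈ Finset.univ.erase p, (τ z).val :=
        (Finset.add_sum_erase _ _ (Finset.mem_univ p)).symm
      have e2 : ∑ z, (σ z).val = (σ p).val + ∑ z ∈ Finset.univ.erase p, (σ z).val :=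
        (Finset.add_sum_erase _ _ (Finset.mem_univ p)).symm
      have hq_mem : q ∈ Finset.univ.erase p := Finset.mem_erase.2 ⟨hpq.symm, Finset.mem_univ q⟩
      have e3 : ∑ z ∈ Finset.univ.erase p, (τ z).val =
          (τ q).val + ∑ z ∈ (Finset.univ.erase p).erase q, (τ z).val :=
        (Finset.add_sum_erase _ _ hq_mem).symm
      have e4 : ∑ z ∈ Finset.univ.erase p, (σ z).val =
          (σ q).val + ∑ z ∈ (Finset.univ.erase p).erase q, (σ z).val :=
        (Finset.add_sum_erase _ _ hq_mem).symm
      have e5 : ∑ z ∈ (Finset.univ.erase p).erase q, (τ z).val =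
          ∑ z ∈ (Finset.univ.erase p).erase q, (σ z).val := by
        refine Finset.sum_congr rfl fun z hz => ?_
        rw [Finset.mem_erase, Finset.mem_erase] at hz
        rw [hoff z hz.2.1 hz.1]
      rw [e1, e2, e3, e4, e5, hp', hq']
      ring
    omega
  · simp

/-- **`S¹ S¹` correlations of a sector state are half the transverse kernel**: for `ψ` in a
magnetisation sector and `p ≠ q`,
`Re ⟨ψ, S¹_p S¹_q ψ⟩ = ½ Re ⟨ψ, S⁺_p S⁻_q ψ⟩` (`S¹ = ½(S⁺ + S⁻)`, the `S⁺S⁺`/`S⁻S⁻` terms vanish by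
the selection rule, and `Re⟨S⁻_p S⁺_q⟩ = Re⟨S⁺_q S⁻_p⟩ = Re⟨S⁺_p S⁻_q⟩`). [folklore] -/
theorem re_expect_siteSpin_zero_mul {μ : ℝ} {ψ : TensorIndex Λ 2 → ℂ}
    (hψ : ψ ∈ @spinZSector Λ _ _ 1 μ) {p q : Λ} (hpq : p ≠ q) :
    (star ψ ⬝ᵥ (siteSpin 1 p 0 * siteSpin 1 q 0) *ᵥ ψ).re =
      (1 / 2) * (star ψ ⬝ᵥ (onSite p (spinRaise 1) * onSite q (spinLower 1)) *ᵥ ψ).re := by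
  have hexp : (siteSpin 1 p 0 * siteSpin 1 q 0 : Op Λ 2) =
      (1 / 4 : ℂ) • (onSite p (spinRaise 1) * onSite q (spinRaise 1) +
        onSite p (spinRaise 1) * onSite q (spinLower 1) +
        onSite q (spinRaise 1) * onSite p (spinLower 1) +
        onSite p (spinLower 1) * onSite q (spinLower 1)) := by
    rw [MerminWagner.siteSpin_zero_eq, MerminWagner.siteSpin_zero_eq, smul_mul_smul_comm, mul_add,
      add_mul, add_mul, onSite_mul_onSite_comm hpq (spinLower 1) (spinRaise 1)]
    rw [show (1 / 2 : ℂ) * (1 / 2) = 1 / 4 by norm_num]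
    congr 1
    abel
  rw [hexp, smul_mulVec, dotProduct_smul, add_mulVec, add_mulVec, add_mulVec, dotProduct_add,
    dotProduct_add, dotProduct_add, expect_raise_raise_eq_zero hψ hpq,
    expect_lower_lower_eq_zero hψ hpq, zero_add, add_zero, smul_eq_mul, Complex.mul_re]
  have hre : ((1 / 4 : ℂ)).re = 1 / 4 := by norm_num
  have him : ((1 / 4 : ℂ)).im = 0 := by norm_num
  rw [hre, him, zero_mul, sub_zero, Complex.add_re, re_expect_raiseLower_symm 1 ψ q p]
  ring

end Sector

/-! ### The odd-shift Hankel form of the two-row transverse row function -/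

section Hankel

variable (M : ℕ) {m : ℕ} [NeZero M]

/-- The two-row left family of sites `x(i, b) = (i, b)`, `i < m`, `b < 2`, lies in the left half
`{x : x₀ ∈ {0, …, M/2 - 1}}` of the planes `(j, a) = (0, -1)` when `M = 2m`. [folklore] -/
theorem twoRowSite_mem_torusLeftHalf (hM : M = 2 * m) (I : Fin m × Fin 2) :
    (![((I.1 : ℕ) : ZMod M), ((I.2 : ℕ) : ZMod M)] : TorusSite 2 M) ∈ torusLeftHalf M 0 (-1) := by
  rw [mem_torusLeftHalf]
  simp only [Matrix.cons_val_zero, neg_add_cancel, sub_zero]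
  rw [ZMod.val_natCast, Nat.mod_eq_of_lt (by omega)]
  omega

omit [NeZero M] in
/-- The reflection of a two-row site in the planes `(0, -1)`: `θ(i, b) = (-1 - i, b)`. [folklore] -/
theorem reflect_twoRowSite (i b : ZMod M) :
    Torus.reflectBetweenSites (0 : Fin 2) (-1 : ZMod M) (![i, b] : TorusSite 2 M) = ![-1 - i, b] := by
  rw [Torus.reflectBetweenSites_apply]
  funext l
  fin_cases l
  · simp only [Fin.zero_eta, Function.update_self, Matrix.cons_val_zero]
    ring
  · simp only [Fin.mk_one, ne_eq, one_ne_zero, not_false_eq_true, Function.update_of_ne,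
      Matrix.cons_val_one, Matrix.cons_val_zero]

omit [NeZero M] in
/-- Difference of a two-row site and a reflected two-row site:
`(i', b') - θ(i, b) = (i + i' + 1, b' - b)`. [folklore] -/
theorem twoRowSite_sub_reflect (i i' b b' : ZMod M) :
    (![i', b'] : TorusSite 2 M) - Torus.reflectBetweenSites (0 : Fin 2) (-1 : ZMod M) ![i, b] =
      ![i + i' + 1, b' - b] := by
  rw [reflect_twoRowSite]
  funext l
  fin_cases l
  · simp only [Fin.zero_eta, Pi.sub_apply, Matrix.cons_val_zero]
    ring
  · simp only [Fin.mk_one, Pi.sub_apply, Matrix.cons_val_one, Matrix.cons_val_zero]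

omit [NeZero M] in
/-- A two-row site and a reflected two-row site differ (`i + i' + 1 < M`). [folklore] -/
theorem twoRowSite_ne_reflect (hM : M = 2 * m) (i i' : Fin m) (b b' : Fin 2) :
    (![((i' : ℕ) : ZMod M), ((b' : ℕ) : ZMod M)] : TorusSite 2 M) ≠
      Torus.reflectBetweenSites (0 : Fin 2) (-1 : ZMod M) ![((i : ℕ) : ZMod M), ((b : ℕ) : ZMod M)] := by
  intro h
  have h0 := congrFun h 0
  rw [reflect_twoRowSite] at h0
  simp only [Matrix.cons_val_zero] at h0
  -- `i' = -1 - i` in `ℤ/M`, i.e. `i + i' + 1 = 0`, impossible as `0 < i + i' + 1 < M`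
  have h1 : (((i : ℕ) + (i' : ℕ) + 1 : ℕ) : ZMod M) = 0 := by
    push_cast
    rw [h0]
    ring
  rw [ZMod.natCast_eq_zero_iff] at h1
  have := Nat.le_of_dvd (by omega) h1
  omega

/-- **From ground-state reflection positivity to the odd-shift Hankel form.** Let `ψ` be a
normalised `S^z_tot = 0` sector ground state of `H_M(Δ)` on the even torus, `M = 2m`, whose
transverse `S¹S¹` Gram matrices across the planes `(0, -1)` are positive semidefinite (ground-state
reflection positivity, `sectorGS_transverseGram_posSemidef_of_sectorGS`: automatic for `Δ ≤ 0`,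
even `M ≥ 4`). Then the odd-shift Hankel form of the
two-row transverse row function `F(s) = Σ_{b,b'<2} Re⟨ψ, S⁺_{(s, b'-b)} S⁻_0 ψ⟩` on `ℝ^m` is
positive semidefinite: testing the Gram matrix of the `2m` sites `(i, b)` with the row-constant real
vector `c_i` gives `½ Σ_{i,i'} c_i c_{i'} F(i + i' + 1)`. [folklore] -/
theorem rowHankelOddForm_nonneg (hM : M = 2 * m) (hEven : Even M) (h4 : 4 ≤ M) (Δ : ℝ)
    (hΔ : Δ ≤ 0) (ψ : TensorIndex (TorusSite 2 M) 2 → ℂ)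
    (hψ : ψ ∈ @spinZSector (TorusSite 2 M) _ _ 1 0) (hnorm : star ψ ⬝ᵥ ψ = 1)
    (heig : Matrix.mulVec (xxzHamiltonian 1 (torusGraph 2 M) (-1) Δ) ψ =
      ((lowestEnergyInSector 1 (xxzHamiltonian 1 (torusGraph 2 M) (-1) Δ) 0 : ℝ) : ℂ) • ψ)
    (c : Fin m → ℝ) :
    0 ≤ hankelOddForm (fun s : ℕ => ∑ b : Fin 2, ∑ b' : Fin 2,
        (star ψ ⬝ᵥ (onSite (![((s : ℕ) : ZMod M), ((b' : ℕ) : ZMod M) - ((b : ℕ) : ZMod M)] :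
          TorusSite 2 M) (spinRaise 1) * onSite 0 (spinLower 1)) *ᵥ ψ).re) m c c := by
  classical
  -- the two-row family and the row-constant test vector
  set x : Fin m × Fin 2 → TorusSite 2 M := fun I => ![((I.1 : ℕ) : ZMod M), ((I.2 : ℕ) : ZMod M)]
    with hx
  set G : Matrix (Fin m × Fin 2) (Fin m × Fin 2) ℂ := Matrix.of fun i l => star ψ ⬝ᵥ
      ((siteSpin 1 (x l) 0 * siteSpin 1 (Torus.reflectBetweenSites 0 (-1) (x i)) 0) *ᵥ ψ) with hGdef
  have hGpsd : G.PosSemidef := sectorGS_transverseGram_posSemidef_of_sectorGS M hEven h4 hΔ hnorm heig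
    0 (-1) x fun I => twoRowSite_mem_torusLeftHalf M hM I
  set v : Fin m × Fin 2 → ℂ := fun I => ((c I.1 : ℝ) : ℂ) with hv
  have hnn : 0 ≤ star v ⬝ᵥ (G *ᵥ v) := hGpsd.dotProduct_mulVec_nonneg v
  have hre : 0 ≤ (star v ⬝ᵥ (G *ᵥ v)).re := (Complex.le_def.1 hnn).1
  -- entries: `Re G_{IJ} = ½ F-term`
  have hentry : ∀ I J : Fin m × Fin 2, (G I J).re = 1 / 2 *
      (star ψ ⬝ᵥ (onSite (![(((I.1 : ℕ) + (J.1 : ℕ) + 1 : ℕ) : ZMod M),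
        ((J.2 : ℕ) : ZMod M) - ((I.2 : ℕ) : ZMod M)] : TorusSite 2 M) (spinRaise 1) *
          onSite 0 (spinLower 1)) *ᵥ ψ).re := by
    intro I J
    rw [hGdef, Matrix.of_apply, re_expect_siteSpin_zero_mul hψ (twoRowSite_ne_reflect M hM I.1 J.1 I.2 J.2),
      gs_transverseKernel_eq_sub M hEven Δ ψ hψ hnorm heig, twoRowSite_sub_reflect]
    have hV : (![(((I.1 : ℕ) + (J.1 : ℕ) + 1 : ℕ) : ZMod M),
        ((J.2 : ℕ) : ZMod M) - ((I.2 : ℕ) : ZMod M)] : TorusSite 2 M) =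
        ![((I.1 : ℕ) : ZMod M) + ((J.1 : ℕ) : ZMod M) + 1, ((J.2 : ℕ) : ZMod M) - ((I.2 : ℕ) : ZMod M)] := by
      push_cast
      rfl
    rw [hV]
  -- the quadratic form, real part
  have hform : (star v ⬝ᵥ (G *ᵥ v)).re = ∑ I : Fin m × Fin 2, ∑ J : Fin m × Fin 2,
      c I.1 * c J.1 * (G I J).re := by
    rw [dotProduct, Complex.re_sum]
    refine Finset.sum_congr rfl fun I _ => ?_
    rw [mulVec, dotProduct, Finset.mul_sum, Complex.re_sum]
    refine Finset.sum_congr rfl fun J _ => ?_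
    rw [hv]
    simp only [Pi.star_apply, Complex.star_def, Complex.conj_ofReal]
    rw [show ((c I.1 : ℝ) : ℂ) * (G I J * ((c J.1 : ℝ) : ℂ)) = (((c I.1 * c J.1 : ℝ)) : ℂ) * G I J by
      push_cast; ring, Complex.re_ofReal_mul]
  rw [hform] at hre
  simp_rw [hentry] at hre
  -- regroup: sum over (i,b),(i',b') of c_i c_{i'} ½ κ = ½ Σ_{i,i'} c_i c_{i'} F(i+i'+1)
  have hregroup : ∑ I : Fin m × Fin 2, ∑ J : Fin m × Fin 2, c I.1 * c J.1 * (1 / 2 *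
      (star ψ ⬝ᵥ (onSite (![(((I.1 : ℕ) + (J.1 : ℕ) + 1 : ℕ) : ZMod M),
        ((J.2 : ℕ) : ZMod M) - ((I.2 : ℕ) : ZMod M)] : TorusSite 2 M) (spinRaise 1) *
          onSite 0 (spinLower 1)) *ᵥ ψ).re) =
      1 / 2 * hankelOddForm (fun s : ℕ => ∑ b : Fin 2, ∑ b' : Fin 2,
        (star ψ ⬝ᵥ (onSite (![((s : ℕ) : ZMod M), ((b' : ℕ) : ZMod M) - ((b : ℕ) : ZMod M)] :
          TorusSite 2 M) (spinRaise 1) * onSite 0 (spinLower 1)) *ᵥ ψ).re) m c c := by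
    rw [hankelOddForm, Finset.mul_sum, Fintype.sum_prod_type]
    refine Finset.sum_congr rfl fun i _ => ?_
    simp_rw [Fintype.sum_prod_type]
    rw [Finset.sum_comm, Finset.mul_sum]
    refine Finset.sum_congr rfl fun i' _ => ?_
    simp only [Finset.mul_sum]
    refine Finset.sum_congr rfl fun b _ => Finset.sum_congr rfl fun b' _ => ?_
    ring
  rw [hregroup] at hre
  linarith

/-- **Registered form** (sub-goal `rowHankelOddForm_nonneg_all` of stmt-HubbardSuperconductivity-15048):
the `∀`-closed statement of `rowHankelOddForm_nonneg`. [folklore] -/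
theorem rowHankelOddForm_nonneg_all :
    ∀ (M m : ℕ) [NeZero M], M = 2 * m → Even M → 4 ≤ M → ∀ (Δ : ℝ), Δ ≤ 0 → ∀ (ψ : TensorIndex
      (TorusSite 2 M) 2 → ℂ), ψ ∈ @spinZSector (TorusSite 2 M) _ _ 1 0 → star ψ ⬝ᵥ ψ = 1 →
      Matrix.mulVec (xxzHamiltonian 1 (torusGraph 2 M) (-1) Δ) ψ = ((lowestEnergyInSector 1
      (xxzHamiltonian 1 (torusGraph 2 M) (-1) Δ) 0 : ℝ) : ℂ) • ψ → ∀ (c : Fin m → ℝ), 0 ≤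
      hankelOddForm (fun s : ℕ => ∑ b : Fin 2, ∑ b' : Fin 2, (star ψ ⬝ᵥ Matrix.mulVec (onSite (![((s
      : ℕ) : ZMod M), ((b' : ℕ) : ZMod M) - ((b : ℕ) : ZMod M)] : TorusSite 2 M) (spinRaise 1) *
      onSite 0 (spinLower 1)) ψ).re) m c c :=
  fun M _ _ hM hEven h4 Δ hΔ ψ hψ hnorm heig c =>
    rowHankelOddForm_nonneg M hM hEven h4 Δ hΔ ψ hψ hnorm heig c

end Hankel

end Summit.HubbardSuperconductivity.HubbardSuperconductivity.Theorems.LevyLogBootstrap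

end
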